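import Summits.ResolutionOfSingularities.ResolutionOfSingularities.Theorems.FrobeniusLadderFInjectiveMacaulayficationG5wData
import Summits.ResolutionOfSingularities.ResolutionOfSingularities.Theorems.FrobeniusLadderFInjectiveMacaulayficationFedderViaSlicing
import Summits.ResolutionOfSingularities.ResolutionOfSingularities.Theorems.FrobeniusLadderFInjectiveMacaulayficationHFedderCertificates
import Summits.ResolutionOfSingularities.ResolutionOfSingularities.Theorems.FrobeniusLadderFInjectiveMacaulayficationClauseOfPderivNotMem
import Mathlib.Algebra.MvPolynomial.Degrees
import Mathlib.Algebra.MvPolynomial.PDeriv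
import Mathlib.Algebra.CharP.Lemmas
import HarnessLib

/-!
# The punctured `(10,15,45,18)`-cone `z² + (y² + x³)³ + w⁵` is clause-good at `p = 7`: Fedder along a CUSPIDAL CURVE
# (crux `FInjectiveMacaulayfication`, line `graded-engine` §17 filtered engine, calibration G6h = idea-1 matrix row 13)

Support file for crux stmt-ResolutionOfSingularities-15315 (`FrobeniusLadder.FInjectiveMacaulayfication`), chain w45a,
seat res-L1-w45a-stub-3. [OURS · L1 W4.5a; idea-1 r2 TEST MATRIX row 13 («transversal E₈ F-pure»)] — NOT a statement of the
manuscript; AI-written, weaker than expert review.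

The initial form `F₀ = X₂² + (X₁² + X₀³)³ + X₃⁵` of idea-1's control specimen is singular (at `p = 7`) exactly along the cuspidal
curve `Γ = {X₂ = X₃ = 0, φ = 0}`, `φ = X₁² + X₀³` — a NON-linear stratum. `g5wCone_clause_char7` proves the filtered engine's cone
hypothesis `hoff₀` at every maximal ideal off the origin over every field of characteristic `7`: Jacobian off `Γ`
(`∂₂ = 2X₂`, `∂₃ = 5X₃⁴`, `∂₁ = 6X₁φ²`, `∂₀ = 9X₀²φ²`), and ALONG `Γ ∖ 0` the generic certificate `FedderViaSlicing.clause_of_sliceCoeff`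
with the plane slicing of `HFedderCertificates` (base `k[X₀,X₁]`, slices `X₂, X₃`): the `Y₀⁶Y₁⁵`-coefficient of `(Y₀² + Y₁⁵ + φ³)⁶` is
`C(6,3)·C(3,1)·φ⁶ = 60·φ⁶` (`FedderViaSlicing.coeff_X_pow_add_pow` twice), `60` is a unit, `6 = p - 1`, and `∂φ/∂X₁ = 2X₁ ∉ 𝔭` on
`Γ ∖ 0` — the cusp `φ` is regular off its vertex, so Fedder read backwards forbids `φ⁶ ∈ 𝔭^[7]` (transversal type `E₈`-like double
point, F-pure at `p = 7`, as idea-1 computed on `GF(7)`/`GF(49)`-points; here over every field).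

Also: `isUnit_natCast_of_not_dvd` (units `q` with `p ∤ q` in `k[X]`). All proofs are glue on Mathlib and landed files; no definitions,
no named facts. References: [Fedder1983] R. Fedder, *F-purity and rational singularity*, Trans. AMS 278 (1983), Thm. 1.12 (through
the imported criterion). [folklore]
-/

-- single-problem summit: the doubled namespace component is forced
set_option linter.dupNamespace false

noncomputable section

namespace Summit.ResolutionOfSingularities.ResolutionOfSingularities.Theorems.FInjectiveMacaulayfication.G5wConeClause

open MvPolynomial IsLocalRing
open Summit.ResolutionOfSingularities.ResolutionOfSingularities.Theorems.FInjectiveMacaulayfication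

/-- In characteristic `p`, a natural number not divisible by `p` is a unit of `k[X]`. [folklore] -/
theorem isUnit_natCast_of_not_dvd (p : ℕ) [Fact p.Prime] (k : Type) [Field k] [CharP k p] {σ : Type*} (q : ℕ)
    (hq : ¬ p ∣ q) : IsUnit ((q : ℕ) : MvPolynomial σ k) := by
  have hk : ((q : ℕ) : k) ≠ 0 := by
    rw [Ne, CharP.cast_eq_zero_iff k p q]
    exact hq
  have h := (isUnit_iff_ne_zero.mpr hk).map (C : k →+* MvPolynomial σ k)
  rwa [map_natCast] at h

/-- **THE CONE CLAUSE `hoff₀` FOR `F₀ = z² + (y² + x³)³ + w⁵` AT `p = 7`**: at every maximal ideal `Q` of `k[X₀,…,X₃]/(F₀)` missing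
some `x̄ⱼ`, the local ring satisfies the Cohen–Macaulay + Frobenius-closed clause (Jacobian off the cuspidal curve `Γ`, Fedder via
slicing along `Γ ∖ 0`). [cite: Fedder1983, Thm. 1.12] -/
theorem g5wCone_clause_char7 (k : Type) [Field k] [CharP k 7] (F : MvPolynomial (Fin 4) k)
    (hF : F = MvPolynomial.X 2 ^ 2 + (MvPolynomial.X 1 ^ 2 + MvPolynomial.X 0 ^ 3) ^ 3 + MvPolynomial.X 3 ^ 5) :
    ∀ (Q : Ideal (MvPolynomial (Fin 4) k ⧸ Ideal.span {F})) [Q.IsMaximal],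
      (∃ j : Fin 4, Ideal.Quotient.mk (Ideal.span {F}) (MvPolynomial.X j) ∉ Q) →
      ∀ d : ℕ, ringKrullDim (Localization.AtPrime Q) = d → ∀ s : Fin d → Localization.AtPrime Q,
        (Ideal.span (Set.range s)).radical.IsMaximal →
          RingTheory.Sequence.IsWeaklyRegular (Localization.AtPrime Q) (List.ofFn s) ∧
          ∀ y : Localization.AtPrime Q, (∃ e : ℕ, y ^ 7 ^ e ∈ Ideal.span
            ((fun z : Localization.AtPrime Q => z ^ 7 ^ e) ''
              (Ideal.span (Set.range s) : Set (Localization.AtPrime Q)))) → y ∈ Ideal.span (Set.range s) := by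
  haveI : Fact (Nat.Prime 7) := ⟨by norm_num⟩
  intro Q _ hj d hd s hs
  haveI hPmax : (Q.comap (Ideal.Quotient.mk (Ideal.span {F}))).IsMaximal :=
    Ideal.comap_isMaximal_of_surjective _ Ideal.Quotient.mk_surjective
  have hP := hPmax.isPrime
  -- units
  have hu2 : IsUnit (2 : MvPolynomial (Fin 4) k) := by simpa using isUnit_natCast_of_not_dvd 7 k 2 (by decide)
  have hu5 : IsUnit (5 : MvPolynomial (Fin 4) k) := by simpa using isUnit_natCast_of_not_dvd 7 k 5 (by decide)
  have hu6 : IsUnit (6 : MvPolynomial (Fin 4) k) := by simpa using isUnit_natCast_of_not_dvd 7 k 6 (by decide)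
  have hu9 : IsUnit (9 : MvPolynomial (Fin 4) k) := by simpa using isUnit_natCast_of_not_dvd 7 k 9 (by decide)
  -- partial derivatives
  have hF' : F = X 2 ^ 2 + (X 1 ^ 2 + X 0 ^ 3) ^ 3 + (0 : ℕ) • X 0 ^ 10 + X 3 ^ 5 := by rw [hF, zero_smul, add_zero]
  have hd0 : pderiv 0 F = 9 * X 0 ^ 2 * (X 1 ^ 2 + X 0 ^ 3) ^ 2 := by rw [hF, G5wData.pderiv_zero_F0]
  have hd1 : pderiv 1 F = 6 * X 1 * (X 1 ^ 2 + X 0 ^ 3) ^ 2 := by rw [hF', G5wData.pderiv_one_g5w]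
  have hd2 : pderiv 2 F = 2 * X 2 := by rw [hF', G5wData.pderiv_two_g5w]
  have hd3 : pderiv 3 F = 5 * X 3 ^ 4 := by rw [hF', G5wData.pderiv_three_g5w]
  -- Jacobian exits
  by_cases m2 : pderiv 2 F ∈ Q.comap (Ideal.Quotient.mk (Ideal.span {F})); swap
  · exact ClauseOfPderivNotMem.stub_clauseOfPderivNotMem 7 k 4 F Q 2 m2 d hd s hs
  by_cases m3 : pderiv 3 F ∈ Q.comap (Ideal.Quotient.mk (Ideal.span {F})); swap
  · exact ClauseOfPderivNotMem.stub_clauseOfPderivNotMem 7 k 4 F Q 3 m3 d hd s hs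
  by_cases m1 : pderiv 1 F ∈ Q.comap (Ideal.Quotient.mk (Ideal.span {F})); swap
  · exact ClauseOfPderivNotMem.stub_clauseOfPderivNotMem 7 k 4 F Q 1 m1 d hd s hs
  by_cases m0 : pderiv 0 F ∈ Q.comap (Ideal.Quotient.mk (Ideal.span {F})); swap
  · exact ClauseOfPderivNotMem.stub_clauseOfPderivNotMem 7 k 4 F Q 0 m0 d hd s hs
  -- on the curve `Γ`: `X₂, X₃, φ ∈ P`
  have hX2 : (X 2 : MvPolynomial (Fin 4) k) ∈ Q.comap (Ideal.Quotient.mk (Ideal.span {F})) := by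
    rw [hd2] at m2
    exact (Ideal.unit_mul_mem_iff_mem _ hu2).mp m2
  have hX3 : (X 3 : MvPolynomial (Fin 4) k) ∈ Q.comap (Ideal.Quotient.mk (Ideal.span {F})) := by
    rw [hd3] at m3
    exact hP.mem_of_pow_mem 4 ((Ideal.unit_mul_mem_iff_mem _ hu5).mp m3)
  have hφ : (X 1 ^ 2 + X 0 ^ 3 : MvPolynomial (Fin 4) k) ∈ Q.comap (Ideal.Quotient.mk (Ideal.span {F})) := by
    rw [hd1, mul_assoc] at m1
    rw [hd0, mul_assoc] at m0
    rcases hP.mem_or_mem ((Ideal.unit_mul_mem_iff_mem _ hu6).mp m1) with h1 | h1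
    · rcases hP.mem_or_mem ((Ideal.unit_mul_mem_iff_mem _ hu9).mp m0) with h0 | h0
      · exact Ideal.add_mem _ (Ideal.pow_mem_of_mem _ h1 2 (by norm_num))
          (Ideal.pow_mem_of_mem _ (hP.mem_of_pow_mem 2 h0) 3 (by norm_num))
      · exact hP.mem_of_pow_mem 2 h0
    · exact hP.mem_of_pow_mem 2 h1
  have hX1 : (X 1 : MvPolynomial (Fin 4) k) ∉ Q.comap (Ideal.Quotient.mk (Ideal.span {F})) := by
    intro hX1
    have hX0 : (X 0 : MvPolynomial (Fin 4) k) ∈ Q.comap (Ideal.Quotient.mk (Ideal.span {F})) := by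
      refine hP.mem_of_pow_mem 3 ?_
      have e : (X 0 ^ 3 : MvPolynomial (Fin 4) k) = (X 1 ^ 2 + X 0 ^ 3) - X 1 * X 1 := by ring
      rw [e]
      exact Ideal.sub_mem _ hφ (Ideal.mul_mem_left _ _ hX1)
    obtain ⟨j, hj⟩ := hj
    apply hj
    fin_cases j
    · exact Ideal.mem_comap.mp hX0
    · exact Ideal.mem_comap.mp hX1
    · exact Ideal.mem_comap.mp hX2
    · exact Ideal.mem_comap.mp hX3
  -- the plane slicing (base `X₀, X₁`; slices `X₂, X₃`)
  obtain ⟨Ψ, hΨ0, hΨ1, hΨ2, hΨ3⟩ := HFedderCertificates.exists_planeSlicing k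
  have hy0 : Ψ.symm (X 0) = X 2 := Ψ.symm_apply_eq.mpr hΨ2.symm
  have hy1 : Ψ.symm (X 1) = X 3 := Ψ.symm_apply_eq.mpr hΨ3.symm
  have hb1 : Ψ.symm (C (X 1)) = X 1 := Ψ.symm_apply_eq.mpr hΨ1.symm
  have hy : ∀ t : Fin 2, Ψ.symm (X t) ∈ Q.comap (Ideal.Quotient.mk (Ideal.span {F})) := by
    intro t
    fin_cases t
    · exact hy0 ▸ hX2
    · exact hy1 ▸ hX3
  have hF0 : F ≠ 0 := hF ▸ G5wData.F0_ne_zero k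
  -- the extracted coefficient: `60 · φ⁶`
  have hΨF : Ψ F = X 0 ^ 2 + (X 1 ^ 5 + C ((X 1 ^ 2 + X 0 ^ 3) ^ 3)) := by
    rw [hF]
    simp only [map_add, map_pow, hΨ0, hΨ1, hΨ2, hΨ3]
    ring
  have hu0 : degreeOf 0 (X 1 ^ 5 + C ((X 1 ^ 2 + X 0 ^ 3) ^ 3) : MvPolynomial (Fin 2) (MvPolynomial (Fin 2) k)) = 0 := by
    apply Nat.eq_zero_of_le_zero
    refine (degreeOf_add_le _ _ _).trans (max_le ?_ ?_)
    · refine (degreeOf_pow_le _ _ _).trans ?_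
      rw [degreeOf_X, if_neg (by decide), mul_zero]
    · rw [degreeOf_C]
  have hcoeff : coeff (Finsupp.single (0 : Fin 2) (2 * 3) + (Finsupp.single 1 (5 * 1) + 0)) (Ψ (F ^ (7 - 1))) =
      (((Nat.choose 6 3 : ℕ) : MvPolynomial (Fin 2) k) * ((Nat.choose 3 1 : ℕ) : MvPolynomial (Fin 2) k)) *
        (X 1 ^ 2 + X 0 ^ 3) ^ 6 := by
    rw [map_pow, hΨF, show (7 - 1 : ℕ) = 6 from rfl,
      FedderViaSlicing.coeff_X_pow_add_pow 0 2 6 3 (by norm_num) (by norm_num) _ hu0 _ (by simp),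
      show (6 - 3 : ℕ) = 3 from rfl,
      FedderViaSlicing.coeff_X_pow_add_pow 1 5 3 1 (by norm_num) (by norm_num) _ (degreeOf_C _ _) 0 (by simp),
      show (3 - 1 : ℕ) = 2 from rfl, ← map_pow, coeff_zero_C, ← pow_mul]
    ring
  have hu : IsUnit (((Nat.choose 6 3 : ℕ) : MvPolynomial (Fin 2) k) * ((Nat.choose 3 1 : ℕ) : MvPolynomial (Fin 2) k)) := by
    rw [show Nat.choose 6 3 = 20 by decide, show Nat.choose 3 1 = 3 by decide]
    exact (isUnit_natCast_of_not_dvd 7 k 20 (by decide)).mul (isUnit_natCast_of_not_dvd 7 k 3 (by decide))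
  have hdslice : ∀ t : Fin 2, (Finsupp.single (0 : Fin 2) (2 * 3) + (Finsupp.single 1 (5 * 1) + 0) : Fin 2 →₀ ℕ) t < 7 := by
    intro t
    fin_cases t <;> simp
  -- `∂φ/∂X₁ = 2X₁ ∉ 𝔭`
  have hdn : pderiv 1 (X 1 ^ 2 + X 0 ^ 3 : MvPolynomial (Fin 2) k) ∉
      (Q.comap (Ideal.Quotient.mk (Ideal.span {F}))).comap (Ψ.symm.toRingHom.comp C) := by
    have e : pderiv 1 (X 1 ^ 2 + X 0 ^ 3 : MvPolynomial (Fin 2) k) = 2 * X 1 := by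
      simp only [map_add, pderiv_pow, pderiv_X_self, pderiv_X_of_ne (show (0 : Fin 2) ≠ 1 by decide)]
      norm_num
    rw [e]
    intro h2
    have hu2' : IsUnit (2 : MvPolynomial (Fin 2) k) := by simpa using isUnit_natCast_of_not_dvd 7 k 2 (by decide)
    have h1 := Ideal.mem_comap.mp ((Ideal.unit_mul_mem_iff_mem _ hu2').mp h2)
    rw [RingHom.comp_apply, RingEquiv.toRingHom_eq_coe, RingEquiv.coe_toRingHom, hb1] at h1
    exact hX1 h1
  exact FedderViaSlicing.clause_of_sliceCoeff 7 k Ψ F hF0 Q hy _ hdslice _ (X 1 ^ 2 + X 0 ^ 3) hu 6 (by norm_num) hcoeff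
    (Or.inr ⟨1, hdn⟩) d hd s hs

end Summit.ResolutionOfSingularities.ResolutionOfSingularities.Theorems.FInjectiveMacaulayfication.G5wConeClause

end
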